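import Summits.FinalStateConjecture.FinalStateConjecture.Theses.KerrnessPropagates
import Summits.FinalStateConjecture.FinalStateConjecture.Theorems.EIHFluxBalanceInertialRecessionLorentz
import Literature.Geometry.Lorentzian.KerrSchildChartCovariance
import Literature.Geometry.Lorentzian.MultiCentreKerrSchild
import Summits.FinalStateConjecture.FinalStateConjecture.Theorems.NecksCertify.Negative.NecksCertifyFalseOfEqualVelocityBinaryWitness

/-!
# Route `KerrnessPropagates`, crux `KerrBasinCapture` (stmt-FinalStateConjecture-17646), line `registered`
# (skeleton `Cruxes/KerrBasinCapture/Lines/birth.lean`, lead rev 3) — stub `stub_largeNearZones`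

**Small accuracy forces large near zones (T2a).** For margins `(N₀, m₀, χ, μ, v₀, L₀)` and a target
radius `R₁` there is `ε₀ > 0` (depending on nothing else) such that, for every multi-Kerr
configuration in the margins and all late lab times `τ`, a hand-over slab at lab time `τ` of
accuracy `ε ≤ ε₀` has all near-zone radii `R j ≥ R₁`.

Proof (all `C⁰`).  If `R j < R₁`, evaluate at the boosted polar point `x = Λⱼ(Rⱼ e₃ + s e₀) + cⱼ`
on `{x⁰ = τ}`: its hole-`j` rest-frame radius is exactly `Rⱼ` (outer edge of the near zone of
hole `j`) and `(g_{Kerr,j}(x) − η)(Λⱼe₀, Λⱼe₀) = 2MⱼRⱼ/(Rⱼ² + aⱼ²) ≥ 2H₀(m₀, R₁) > 0`, so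
`‖g_{Kerr,j}(x) − η‖ ≥ 2H₀/L₀²`.  By strict recession every other hole is at lab distance `≳ v₀τ`
from `x`, hence (boosts stretch spatial separations) at rest-frame radius `≳ v₀τ`: `x` is in the
chart domain and `‖g_{Kerr,i}(x) − η‖ ≤ ε₀` for `τ` large (`O(M/r)` decay).  Either `x` is also
in the far zone — then the two `C⁰` deviation bounds give `‖g_{Kerr,j}(x) − η‖ ≤ 2ε` — or it is
in the near zone of another hole `i` — then `‖g_{Kerr,j}(x) − η‖ ≤ 2ε + ε₀`; with
`ε ≤ ε₀ = H₀/(2 max(L₀,1)²)` both contradict the lower bound.  Only the `m = 0` part of the two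
`supCkENorm` hypotheses, the tie `r₀ i + 1 ≤ R i` and the margins are used. [folklore]
-/

open scoped BigOperators Topology Manifold Classical Matrix InnerProductSpace ContinuousMap
open Filter Set Function TopologicalSpace
open Literature.Geometry.Lorentzian

-- D-0017: single-problem summit, `Summit.<S>.<S>.…` by design.
set_option linter.dupNamespace false

namespace Summit.FinalStateConjecture.FinalStateConjecture.Theorems.KerrnessPropagates.KerrBasinCapture

open Summit.FinalStateConjecture.FinalStateConjecture.Theorems

/-! ### Poincaré bookkeeping on the lab slab `{x⁰ = τ}` -/

/-- **The boosted polar evaluation point**: for every motion `(Λ, c)`, lab time `τ` and radius `r`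
there is a lab point `x` with `x⁰ = τ` and rest-frame coordinates `Λ⁻¹(x − c) = r e₃ + s e₀`
(solve the linear time equation; `(Λe₀)⁰ ≠ 0` is
`NecksCertify.Negative.lorentz_basisVector_zero_apply_zero_ne_zero`). [folklore] -/
theorem exists_polarPoint (Λ : lorentzGroup) (c : E4) (τ r : ℝ) :
    ∃ x : E4, x 0 = τ ∧ ∃ s : ℝ,
      poincareInv Λ c x = r • E4.basisVector 3 + s • E4.basisVector 0 := by
  set γ : ℝ := ((Λ : E4 ≃L[ℝ] E4) (E4.basisVector 0)) 0 with hγ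
  have hγ0 : γ ≠ 0 := NecksCertify.Negative.lorentz_basisVector_zero_apply_zero_ne_zero Λ
  set s : ℝ := (τ - c 0 - r * ((Λ : E4 ≃L[ℝ] E4) (E4.basisVector 3)) 0) / γ with hs
  refine ⟨(Λ : E4 ≃L[ℝ] E4) (r • E4.basisVector 3 + s • E4.basisVector 0) + c, ?_, s, ?_⟩
  · simp only [hs, PiLp.add_apply, map_add, map_smul, PiLp.smul_apply, smul_eq_mul, ← hγ,
      div_mul_cancel₀ _ hγ0]
    ring
  · simp [poincareInv]

/-- **The lab worldline point at lab time `τ`**: the point `p = c + σΛe₀` with `p⁰ = τ` has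
rest-frame coordinates `σ e₀` and lab position `c~ + (τ − c⁰)V`, `V = (Λe₀)⁰⁻¹ (Λe₀)~`. [folklore] -/
theorem exists_centre (Λ : lorentzGroup) (c : E4) (τ : ℝ) :
    ∃ p : E4, p 0 = τ ∧ (∃ σ : ℝ, poincareInv Λ c p = σ • E4.basisVector 0) ∧
      E4.spatial p = E4.spatial c + (τ - c 0) •
        ((((Λ : E4 ≃L[ℝ] E4) (E4.basisVector 0)) 0)⁻¹ •
          E4.spatial ((Λ : E4 ≃L[ℝ] E4) (E4.basisVector 0))) := by
  set γ : ℝ := ((Λ : E4 ≃L[ℝ] E4) (E4.basisVector 0)) 0 with hγ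
  have hγ0 : γ ≠ 0 := NecksCertify.Negative.lorentz_basisVector_zero_apply_zero_ne_zero Λ
  refine ⟨c + ((τ - c 0) / γ) • (Λ : E4 ≃L[ℝ] E4) (E4.basisVector 0), ?_, ⟨(τ - c 0) / γ, ?_⟩, ?_⟩
  · simp [← hγ, div_mul_cancel₀ _ hγ0]
  · simp [poincareInv]
  · rw [map_add, map_smul, smul_smul, div_eq_mul_inv]

/-- Change of centre: `Λ⁻¹(x − p) = Λ⁻¹(x − c) − Λ⁻¹(p − c)` (Poincaré maps are affine). [folklore] -/
theorem poincareInv_eq_sub (Λ : lorentzGroup) (c p x : E4) :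
    poincareInv Λ p x = poincareInv Λ c x - poincareInv Λ c p := by
  simp only [poincareInv, ← map_sub]
  congr 1
  abel

/-- **Far in the lab ⇒ large painted radius** (centre form of `sq_sub_sq_le_radius_poincareInv_sq`):
for lab points `x`, `p` of equal lab time, `Θ + |a| ≤ ‖x~ − p~‖` with `Θ ≥ 0` forces
`Θ ≤ r_a(Λ⁻¹(x − p))`. [folklore] -/
theorem le_radius_of_le_norm_spatial_sub (Λ : lorentzGroup) (a : ℝ) {x p : E4} (h : x 0 = p 0)
    {Θ : ℝ} (hΘ : 0 ≤ Θ) (hfar : Θ + |a| ≤ ‖E4.spatial x - E4.spatial p‖) :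
    Θ ≤ Kerr.radius a (poincareInv Λ p x) := by
  have h1 := sq_sub_sq_le_radius_poincareInv_sq Λ a (p 0) (E4.spatial p) h
  rw [show E4.ofTimeSpace (p 0) (E4.spatial p) = p from E4.ofTimeSpace_time_spatial p] at h1
  have hD : (Θ + |a|) ^ 2 ≤ ‖E4.spatial x - E4.spatial p‖ ^ 2 :=
    pow_le_pow_left₀ (by positivity) hfar 2
  have h2 : Θ ^ 2 ≤ Kerr.radius a (poincareInv Λ p x) ^ 2 := by
    nlinarith [sq_abs a, mul_nonneg hΘ (abs_nonneg a)]
  exact (pow_le_pow_iff_left₀ hΘ (Kerr.radius_nonneg _ _) two_ne_zero).mp h2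

/-- **Boosts stretch**: for lab points `x`, `p` of equal lab time,
`‖x~ − p~‖ ≤ ‖(Λ⁻¹(x − p))~‖`. [folklore] -/
theorem norm_spatial_sub_le (Λ : lorentzGroup) {x p : E4} (h : x 0 = p 0) :
    ‖E4.spatial x - E4.spatial p‖ ≤ E4.spatialNorm (poincareInv Λ p x) := by
  have h0 : (x - p) 0 = 0 := by simp [h]
  have h1 := norm_le_spatialNorm_lorentz_apply Λ⁻¹ h0
  rw [coe_lorentz_inv] at h1
  calc ‖E4.spatial x - E4.spatial p‖ = ‖E4.spatial (x - p)‖ := by rw [map_sub]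
    _ = ‖x - p‖ := (norm_eq_spatialNorm_of_apply_zero_eq_zero h0).symm
    _ ≤ _ := h1

/-- `‖(r e₃ + t e₀)~‖ = |r|`. [folklore] -/
theorem spatialNorm_polar (r t : ℝ) :
    E4.spatialNorm (r • E4.basisVector 3 + t • E4.basisVector 0 : E4) = |r| := by
  have hs : E4.spatialNorm (r • E4.basisVector 3 + t • E4.basisVector 0 : E4) ^ 2 = r ^ 2 := by
    rw [E4.spatialNorm_sq]
    simp
  rw [← Real.sqrt_sq (E4.spatialNorm_nonneg _), hs, Real.sqrt_sq_eq_abs]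

/-- **Strict recession separates the lab centres**: `‖(dⱼ + τVⱼ) − (dᵢ + τVᵢ)‖ ≥ τ v₀ − K` when
`‖Vⱼ − Vᵢ‖ ≥ v₀`, `‖dⱼ‖ + ‖dᵢ‖ ≤ K`, `τ ≥ 0`. [folklore] -/
theorem sub_le_norm_centre_sub {τ v₀ K : ℝ} (hτ : 0 ≤ τ) {Vj Vi dj di : E3}
    (hv : v₀ ≤ ‖Vj - Vi‖) (hK : ‖dj‖ + ‖di‖ ≤ K) :
    τ * v₀ - K ≤ ‖(dj + τ • Vj) - (di + τ • Vi)‖ := by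
  have h1 : (dj + τ • Vj) - (di + τ • Vi) = τ • (Vj - Vi) + (dj - di) := by
    rw [smul_sub]
    abel
  have h2 : ‖τ • (Vj - Vi)‖ = τ * ‖Vj - Vi‖ := by rw [norm_smul, Real.norm_of_nonneg hτ]
  have h3 : ‖τ • (Vj - Vi)‖ ≤ ‖τ • (Vj - Vi) + (dj - di)‖ + ‖dj - di‖ :=
    norm_le_add_norm_add _ _
  have h4 : ‖dj - di‖ ≤ ‖dj‖ + ‖di‖ := norm_sub_le _ _
  rw [h1]
  nlinarith [mul_le_mul_of_nonneg_left hv hτ]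

/-! ### Kerr–Schild size: lower bound at the polar point, decay far away -/

/-- **Kerr–Schild Kerr is not flat at bounded radius**: at a lab point of hole rest-frame position
`r e₃ + s e₀`, `r > 0`, one has `2Mr/(r² + a²) ≤ ‖g_{Kerr}(x) − η‖ ‖Λe₀‖²` — evaluate the boosted
perturbation on `Λe₀` (`boostedKerrBilin_sub_minkowski_apply`), use stationarity and
`KerrSchildChart.bilin_polar_basisVector_zero`, and `|B(u,u)| ≤ ‖B‖‖u‖²`. [folklore] -/
theorem two_mul_le_norm_boostedKerrBilin_sub (Λ : lorentzGroup) (c : E4) (M a : ℝ) {r : ℝ}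
    (hr : 0 < r) {x : E4} {s : ℝ}
    (hx : poincareInv Λ c x = r • E4.basisVector 3 + s • E4.basisVector 0) :
    2 * (M * r / (r ^ 2 + a ^ 2)) ≤ ‖boostedKerrBilin Λ c M a x - Minkowski.bilin‖ *
      ‖(Λ : E4 ≃L[ℝ] E4) (E4.basisVector 0)‖ ^ 2 := by
  set B := boostedKerrBilin Λ c M a x - Minkowski.bilin with hB
  set u := (Λ : E4 ≃L[ℝ] E4) (E4.basisVector 0) with hu
  have h1 : B u u = 2 * (M * r / (r ^ 2 + a ^ 2)) := by
    rw [hB, hu, boostedKerrBilin_sub_minkowski_apply, ContinuousLinearEquiv.symm_apply_apply, hx,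
      sub_apply, sub_apply, Kerr.bilin_add_smul_basisVector_zero,
      KerrSchildChart.bilin_polar_basisVector_zero M a hr, Minkowski.bilin_basisVector_zero]
    ring
  have h2 := B.le_opNorm₂ u u
  rw [Real.norm_eq_abs] at h2
  calc 2 * (M * r / (r ^ 2 + a ^ 2)) = B u u := h1.symm
    _ ≤ |B u u| := le_abs_self _
    _ ≤ ‖B‖ * ‖u‖ * ‖u‖ := h2
    _ = ‖B‖ * ‖u‖ ^ 2 := by ring

/-- **Decay of a boosted Kerr–Schild term**: if `‖g_{M,a}(y) − η‖ ≤ C/r(y)` for `r(y) ≥ R_d`, then at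
a lab point of rest-frame radius `r ≥ R_d`, `r > 0`, `r ≥ ‖Λ⁻¹‖² max(C,0)/ε₀` the boosted term has
`‖g_{Kerr}(x) − η‖ ≤ ε₀` (`norm_boostedKerrBilin_sub_minkowski_le`). [folklore] -/
theorem norm_boostedKerrBilin_sub_le_of_radius_ge (Λ : lorentzGroup) (c : E4) (M a : ℝ)
    {C Rd ε₀ : ℝ} (hε₀ : 0 < ε₀)
    (hdec : ∀ y : E4, Rd ≤ Kerr.radius a y → ‖Kerr.bilin M a y - Minkowski.bilin‖ ≤
      C / Kerr.radius a y)
    {x : E4} (hRd : Rd ≤ Kerr.radius a (poincareInv Λ c x))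
    (hpos : 0 < Kerr.radius a (poincareInv Λ c x))
    (hbig : ‖((Λ : E4 ≃L[ℝ] E4).symm : E4 →L[ℝ] E4)‖ ^ 2 * max C 0 / ε₀ ≤
      Kerr.radius a (poincareInv Λ c x)) :
    ‖boostedKerrBilin Λ c M a x - Minkowski.bilin‖ ≤ ε₀ := by
  set ρ := Kerr.radius a (poincareInv Λ c x) with hρ
  set n := ‖((Λ : E4 ≃L[ℝ] E4).symm : E4 →L[ℝ] E4)‖ ^ 2 with hn
  have h2 : ‖Kerr.bilin M a (poincareInv Λ c x) - Minkowski.bilin‖ ≤ max C 0 / ρ :=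
    (hdec _ hRd).trans (div_le_div_of_nonneg_right (le_max_left _ _) hpos.le)
  have h3 : n * max C 0 ≤ ε₀ * ρ := by
    have := (div_le_iff₀ hε₀).mp hbig
    linarith
  calc ‖boostedKerrBilin Λ c M a x - Minkowski.bilin‖ ≤ n * (max C 0 / ρ) :=
        (norm_boostedKerrBilin_sub_minkowski_le Λ c M a x).trans
          (mul_le_mul_of_nonneg_left h2 (by positivity))
    _ = n * max C 0 / ρ := by ring
    _ ≤ ε₀ := (div_le_iff₀ hpos).mpr h3

/-- The scale `H₀ = m₀/(R₂(1 + m₀⁻²))` bounds `MR/(R² + a²)` from below on the margin box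
`m₀ ≤ M`, `|a| ≤ m₀⁻¹`, `1 ≤ R ≤ R₂`. [folklore] -/
theorem scale_le_kerr_quotient {m₀ R₂ M a R : ℝ} (hm₀ : 0 < m₀) (hM : m₀ ≤ M) (ha : |a| ≤ m₀⁻¹)
    (hR1 : 1 ≤ R) (hR2 : R ≤ R₂) :
    m₀ / (R₂ * (1 + m₀⁻¹ ^ 2)) ≤ M * R / (R ^ 2 + a ^ 2) := by
  have hRpos : 0 < R := by linarith
  have hR₂pos : 0 < R₂ := by linarith
  have ha2 : a ^ 2 ≤ m₀⁻¹ ^ 2 := by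
    have := pow_le_pow_left₀ (abs_nonneg a) ha 2
    rwa [sq_abs] at this
  have h2 : R ^ 2 + a ^ 2 ≤ R * R₂ * (1 + m₀⁻¹ ^ 2) := by
    have h3 : R ^ 2 ≤ R * R₂ := by nlinarith
    have h4 : (1 : ℝ) ≤ R * R₂ := by nlinarith
    nlinarith [sq_nonneg m₀⁻¹]
  rw [div_le_div_iff₀ (by positivity) (by positivity)]
  calc m₀ * (R ^ 2 + a ^ 2) ≤ m₀ * (R * R₂ * (1 + m₀⁻¹ ^ 2)) :=
        mul_le_mul_of_nonneg_left h2 hm₀.le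
    _ ≤ M * (R * R₂ * (1 + m₀⁻¹ ^ 2)) := mul_le_mul_of_nonneg_right hM (by positivity)
    _ = M * R * (R₂ * (1 + m₀⁻¹ ^ 2)) := by ring

/-- **The margin box, unpacked**: `0 < M`, `|a| ≤ m₀⁻¹` and `μ ≤ r₀` (the last from `0 ≤ r₋` for the
sub-extremal parameters `|a| ≤ χM < M`, `Kerr.IsSubextremal.rMinus_nonneg`). [folklore] -/
theorem margin_facts {m₀ χ μ M a r₀ : ℝ} (hm₀ : 0 < m₀) (hχ : χ < 1) (h1 : m₀ ≤ M)
    (h2 : M ≤ m₀⁻¹) (h3 : |a| ≤ χ * M) (h4 : Kerr.rMinus M a + μ ≤ r₀) :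
    0 < M ∧ |a| ≤ m₀⁻¹ ∧ μ ≤ r₀ := by
  have hM : 0 < M := hm₀.trans_le h1
  have ha : |a| < M := h3.trans_lt (by nlinarith)
  have h5 := Kerr.IsSubextremal.rMinus_nonneg ha
  exact ⟨hM, (ha.le.trans h2), by linarith⟩

/-! ### `C⁰` extraction from the `Cᵏ` sup norms of the slab -/

/-- The `m = 0` instance of a `Cᵏ` sup-norm bound: `‖f x‖ ≤ ε` on the set
(`enorm_iteratedFDeriv_le_supCkENorm`, `norm_iteratedFDeriv_zero`). [folklore] -/
theorem norm_le_of_supCkENorm_le {G : Type*} [NormedAddCommGroup G] [NormedSpace ℝ G]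
    {S : Set E4} {k : ℕ} {f : E4 → G} {ε : ℝ} (hε : 0 ≤ ε)
    (h : supCkENorm S k f ≤ ENNReal.ofReal ε) {x : E4} (hx : x ∈ S) : ‖f x‖ ≤ ε := by
  have h1 := (enorm_iteratedFDeriv_le_supCkENorm (Nat.zero_le k) hx f).trans h
  rwa [← ofReal_norm, norm_iteratedFDeriv_zero, ENNReal.ofReal_le_ofReal_iff hε] at h1

/-- **Two reference backgrounds on one chart domain**: at a point of the domain the pulled-back
metric cancels between the two deviations of the same chart map (`Spacetime.deviationExtend_coe`),
so `C⁰` smallness of both makes the two reference forms close there. [folklore] -/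
theorem norm_sub_bilin_le (𝓢 : Spacetime 4) (B : ModelBackground)
    (b : E4 → E4 →L[ℝ] E4 →L[ℝ] ℝ) (t r : E4 → ℝ) (Ψ : B.domain → 𝓢.carrier) (x : B.domain)
    {ε₁ ε₂ : ℝ} (h₁ : ‖𝓢.deviationExtend B Ψ x‖ ≤ ε₁)
    (h₂ : ‖𝓢.deviationExtend ⟨B.domain, b, t, r⟩ Ψ x‖ ≤ ε₂) :
    ‖b x - B.bilin x‖ ≤ ε₁ + ε₂ := by
  have key : 𝓢.deviationExtend B Ψ x - 𝓢.deviationExtend ⟨B.domain, b, t, r⟩ Ψ x =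
      b x - B.bilin x := by
    rw [Spacetime.deviationExtend_coe, show 𝓢.deviationExtend ⟨B.domain, b, t, r⟩ Ψ x =
      𝓢.deviation ⟨B.domain, b, t, r⟩ Ψ x from Spacetime.deviationExtend_coe 𝓢 ⟨_, b, t, r⟩ Ψ x]
    exact sub_sub_sub_cancel_left (B.bilin (x : E4)) (b (x : E4)) _
  rw [← key]
  calc ‖𝓢.deviationExtend B Ψ x - 𝓢.deviationExtend ⟨B.domain, b, t, r⟩ Ψ x‖
      ≤ ‖𝓢.deviationExtend B Ψ x‖ + ‖𝓢.deviationExtend ⟨B.domain, b, t, r⟩ Ψ x‖ :=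
        norm_sub_le (𝓢.deviationExtend B Ψ x) (𝓢.deviationExtend ⟨B.domain, b, t, r⟩ Ψ x)
    _ ≤ ε₁ + ε₂ := add_le_add h₁ h₂

/-! ### The stub -/

/-- stub T2a — **SMALL ACCURACY FORCES LARGE NEAR ZONES** (registered stub of crux
stmt-FinalStateConjecture-17646, line `registered`): for margins `(N₀, m₀, χ, μ, v₀, L₀)` and a
radius `R₁` there is `ε₀ > 0` such that, for every configuration in the margins and all late lab
times, every hand-over slab of accuracy `ε ≤ ε₀` has near-zone radii `R j ≥ R₁` — Kerr–Schild Kerr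
is `2MR/(R² + a²)`-far from flat at rest-frame radius `R` while, by strict recession, the slab is
`O(ε)`-flat at the outer edge of each near zone. [folklore] -/
theorem stub_largeNearZones : ∀ k : ℕ, ∀ (X : Type) [TopologicalSpace X] [ChartedSpace E3 X] [IsManifold (𝓡 3) (⊤ : ℕ∞) X] [T2Space X] [SecondCountableTopology X] [ConnectedSpace X] (D : InitialDataSet (𝓡 3) X) (𝒟 : VacuumCauchyDevelopment D) (N₀ : ℕ) (m₀ χ μ v₀ L₀ : ℝ), 0 < m₀ → χ < 1 → 0 < μ → 0 < v₀ → ∀ R₁ : ℝ, ∃ ε₀ : ℝ, 0 < ε₀ ∧ ∀ (N : ℕ) (M a r₀ : Fin N → ℝ) (mo : Fin N → ↥lorentzGroup × E4), (N ≤ N₀ ∧ (∀ i, m₀ ≤ M i ∧ M i ≤ m₀⁻¹ ∧ |a i| ≤ χ * M i ∧ Kerr.rMinus (M i) (a i) + μ ≤ r₀ i ∧ r₀ i + μ ≤ Kerr.rPlus (M i) (a i) ∧ ∀ v : E4, ‖((mo i).1 : E4 ≃L[ℝ] E4) v‖ ≤ L₀ * ‖v‖) ∧ (∀ i j, i ≠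 j → v₀ ≤ ‖(((mo i).1 : E4 ≃L[ℝ] E4) (E4.basisVector 0) 0)⁻¹ • E4.spatial (((mo i).1 : E4 ≃L[ℝ] E4) (E4.basisVector 0)) - (((mo j).1 : E4 ≃L[ℝ] E4) (E4.basisVector 0) 0)⁻¹ • E4.spatial (((mo j).1 : E4 ≃L[ℝ] E4) (E4.basisVector 0))‖)) → ∃ T : ℝ, ∀ τ : ℝ, T ≤ τ → ∀ ε : ℝ, 0 < ε → ε ≤ ε₀ → ∀ (R : Fin N → ℝ) (U : Opens E4) (Φ : U → 𝒟.carrier), ((∀ i, r₀ i + 1 ≤ R i) ∧ ContMDiff 𝓘(ℝ, E4) (𝓡 4) (⊤ : ℕ∞) Φ ∧ Topology.IsOpenEmbedding Φ ∧ {x : E4 | x 0 = τ ∧ (∀ j, r₀ j < Kerr.radius (a j) (poincareInv (mo j).1 (mo j).2 x))} ⊆ (U : Set E4) ∧ range Φ ⊆ 𝒟.metric.causalFuture 𝒟.timeOrientation (range 𝒟.embed) ∧ 𝒟.metric.IsAchronal 𝒟.timeOrientation (Φ '' {x : ↥U | (x : E4) 0 = τ}) ∧ (∀ i, supCkENorm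 {x : E4 | x 0 = τ ∧ (∀ j, r₀ j < Kerr.radius (a j) (poincareInv (mo j).1 (mo j).2 x)) ∧ Kerr.radius (a i) (poincareInv (mo i).1 (mo i).2 x) ≤ R i} k (𝒟.toSpacetime.deviationExtend ⟨U, boostedKerrBilin (mo i).1 (mo i).2 (M i) (a i), fun x ↦ x 0, fun x ↦ Kerr.radius (a i) (poincareInv (mo i).1 (mo i).2 x)⟩ Φ) ≤ ENNReal.ofReal ε) ∧ supCkENorm {x : E4 | x 0 = τ ∧ (∀ j, r₀ j < Kerr.radius (a j) (poincareInv (mo j).1 (mo j).2 x)) ∧ ∀ j, R j - 1 ≤ Kerr.radius (a j) (poincareInv (mo j).1 (mo j).2 x)} k (𝒟.toSpacetime.deviationExtend (Minkowski.backgroundOn U) Φ) ≤ ENNReal.ofReal ε ∧ (∀ x : ↥U, x.1 0 = τ → (∀ j, R j - 1 ≤ Kerr.radius (a j) (poincareInv (mo j).1 (mo j).2 x.1)) → 𝒟.timeOrientation.IsFutureDirected (mfderiv 𝓘(ℝ, E4) (𝓡 4) Φ x (E4.basisVector 0)))) → ∀ j, R₁ ≤ R j := by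
  intro k X _ _ _ _ _ _ D 𝒟 N₀ m₀ χ μ v₀ L₀ hm₀ hχ hμ hv₀ R₁
  -- constants depending only on the margins and `R₁`
  obtain ⟨R₂, hR₂pos, hR₂R⟩ : ∃ R₂ : ℝ, 0 < R₂ ∧ R₁ ≤ R₂ := ⟨max R₁ 1, by positivity, le_max_left _ _⟩
  obtain ⟨L₁, hL₁pos, hL₁L⟩ : ∃ L₁ : ℝ, 0 < L₁ ∧ L₀ ≤ L₁ := ⟨max L₀ 1, by positivity, le_max_left _ _⟩
  obtain ⟨H₀, hH₀⟩ : ∃ H₀ : ℝ, H₀ = m₀ / (R₂ * (1 + m₀⁻¹ ^ 2)) := ⟨_, rfl⟩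
  have hH₀pos : 0 < H₀ := by rw [hH₀]; positivity
  obtain ⟨ε₀, hε₀⟩ : ∃ ε₀ : ℝ, ε₀ = H₀ / (2 * L₁ ^ 2) := ⟨_, rfl⟩
  have hε₀pos : 0 < ε₀ := by rw [hε₀]; positivity
  refine ⟨ε₀, hε₀pos, ?_⟩
  rintro N M a r₀ mo ⟨-, hmarg, hsep⟩
  -- per-hole data of the configuration (the late time `T` may depend on all of it)
  choose C Rd hRd hdec using fun i ↦ Kerr.exists_norm_ksPert_le (M i) (a i)
  obtain ⟨V, hV⟩ : ∃ V : Fin N → E3, ∀ i, V i = ((((mo i).1 : E4 ≃L[ℝ] E4) (E4.basisVector 0)) 0)⁻¹ •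
      E4.spatial (((mo i).1 : E4 ≃L[ℝ] E4) (E4.basisVector 0)) := ⟨fun i ↦ _, fun i ↦ rfl⟩
  obtain ⟨d, hd⟩ : ∃ d : Fin N → E3, ∀ i, d i = E4.spatial (mo i).2 - ((mo i).2 0) • V i :=
    ⟨fun i ↦ _, fun i ↦ rfl⟩
  obtain ⟨K₀, hK₀⟩ : ∃ K₀ : ℝ, K₀ = ∑ i, ‖d i‖ := ⟨_, rfl⟩
  obtain ⟨Θ, hΘ⟩ : ∃ Θ : Fin N → ℝ, ∀ i, Θ i = Rd i +
      ‖(((mo i).1 : E4 ≃L[ℝ] E4).symm : E4 →L[ℝ] E4)‖ ^ 2 * max (C i) 0 / ε₀ + r₀ i + 1 :=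
    ⟨fun i ↦ _, fun i ↦ rfl⟩
  obtain ⟨Θs, hΘs⟩ : ∃ Θs : ℝ, Θs = ∑ i, Θ i := ⟨_, rfl⟩
  have hfacts : ∀ i, 0 < M i ∧ |a i| ≤ m₀⁻¹ ∧ μ ≤ r₀ i := fun i ↦
    margin_facts hm₀ hχ (hmarg i).1 (hmarg i).2.1 (hmarg i).2.2.1 (hmarg i).2.2.2.1
  have hΘparts : ∀ i, Rd i ≤ Θ i ∧
      ‖(((mo i).1 : E4 ≃L[ℝ] E4).symm : E4 →L[ℝ] E4)‖ ^ 2 * max (C i) 0 / ε₀ ≤ Θ i ∧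
      r₀ i + 1 ≤ Θ i ∧ 0 < Θ i := fun i ↦ by
    have h1 := hRd i
    have h2 : 0 < r₀ i := hμ.trans_le (hfacts i).2.2
    have h3 : 0 ≤ ‖(((mo i).1 : E4 ≃L[ℝ] E4).symm : E4 →L[ℝ] E4)‖ ^ 2 * max (C i) 0 / ε₀ := by
      positivity
    rw [hΘ i]
    exact ⟨by linarith, by linarith, by linarith, by linarith⟩
  have hΘle : ∀ i, Θ i ≤ Θs := fun i ↦ by
    rw [hΘs]
    exact Finset.single_le_sum (fun i _ ↦ (hΘparts i).2.2.2.le) (Finset.mem_univ i)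
  have hdle : ∀ i, ‖d i‖ ≤ K₀ := fun i ↦ by
    rw [hK₀]
    exact Finset.single_le_sum (fun i _ ↦ norm_nonneg (d i)) (Finset.mem_univ i)
  -- the late time
  refine ⟨(2 * K₀ + R₂ + Θs + m₀⁻¹) / v₀, ?_⟩
  intro τ hτ ε hε hεε₀ R U Φ hslab j
  obtain ⟨hR, -, -, hU, -, -, hnear, hfar, -⟩ := hslab
  have hτv : 2 * K₀ + R₂ + Θs + m₀⁻¹ ≤ τ * v₀ := (div_le_iff₀ hv₀).mp hτ
  have hτnn : 0 ≤ τ := by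
    refine le_trans (div_nonneg ?_ hv₀.le) hτ
    linarith [hdle j, norm_nonneg (d j), hΘle j, (hΘparts j).2.2.2, inv_pos.mpr hm₀]
  by_contra hlt
  push Not at hlt
  -- hole `j`: `1 < R j < R₁ ≤ R₂`
  obtain ⟨-, haj, hr₀j⟩ := hfacts j
  have hRj1 : 1 < R j := by linarith [hR j]
  have hRjpos : 0 < R j := by linarith
  -- the polar evaluation point `x` of hole `j` on the slab `{x⁰ = τ}`
  obtain ⟨x, hx0, s, hxinv⟩ := exists_polarPoint (mo j).1 (mo j).2 τ (R j)
  have hrj : Kerr.radius (a j) (poincareInv (mo j).1 (mo j).2 x) = R j := by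
    rw [hxinv, Kerr.radius_add_time_smul_basisVector, KerrSchildChart.radius_polar _ hRjpos.le]
  -- the lab worldline points of all holes at lab time `τ`
  choose p hp0 hpσ hpsp using fun i ↦ exists_centre (mo i).1 (mo i).2 τ
  have hpsp' : ∀ i, E4.spatial (p i) = d i + τ • V i := fun i ↦ by
    rw [hpsp i, ← hV i, hd i, sub_smul]
    abel
  have hrad : ∀ i (y : E4), Kerr.radius (a i) (poincareInv (mo i).1 (p i) y) =
      Kerr.radius (a i) (poincareInv (mo i).1 (mo i).2 y) := fun i y ↦ by
    obtain ⟨σ, hσ⟩ := hpσ i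
    rw [poincareInv_eq_sub (mo i).1 (mo i).2 (p i) y, hσ, sub_eq_add_neg, ← neg_smul,
      Kerr.radius_add_time_smul_basisVector]
  -- `x` is within lab distance `R j` of its own centre
  have hxj : ‖E4.spatial x - E4.spatial (p j)‖ ≤ R j := by
    have h1 := norm_spatial_sub_le (mo j).1 (x := x) (p := p j) (by rw [hx0, hp0 j])
    obtain ⟨σ, hσ⟩ := hpσ j
    rw [poincareInv_eq_sub (mo j).1 (mo j).2 (p j) x, hσ, hxinv, add_sub_assoc, ← sub_smul,
      spatialNorm_polar, abs_of_pos hRjpos] at h1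
    exact h1
  -- every other hole is far from `x` in its own rest frame
  have hri : ∀ i, i ≠ j → Θ i ≤ Kerr.radius (a i) (poincareInv (mo i).1 (mo i).2 x) := by
    intro i hij
    have hsepij : τ * v₀ - 2 * K₀ ≤ ‖E4.spatial (p j) - E4.spatial (p i)‖ := by
      rw [hpsp' j, hpsp' i]
      refine sub_le_norm_centre_sub hτnn ?_ (by linarith [hdle i, hdle j])
      rw [hV j, hV i]
      exact hsep j i (Ne.symm hij)
    rw [← hrad i x]
    refine le_radius_of_le_norm_spatial_sub (mo i).1 (a i) (by rw [hx0, hp0 i])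
      (hΘparts i).2.2.2.le ?_
    linarith [hΘle i, (hfacts i).2.1, norm_sub_rev (E4.spatial (p j)) (E4.spatial x),
      norm_sub_le_norm_sub_add_norm_sub (E4.spatial (p j)) (E4.spatial x) (E4.spatial (p i))]
  -- hence `x` lies in the chart domain and on the outer edge of the near zone of hole `j`
  have hin : ∀ i, r₀ i < Kerr.radius (a i) (poincareInv (mo i).1 (mo i).2 x) := by
    intro i
    by_cases hij : i = j
    · subst hij
      rw [hrj]
      linarith [hR i]
    · linarith [hri i hij, (hΘparts i).2.2.1]
  have hxU : x ∈ (U : Set E4) := hU ⟨hx0, hin⟩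
  have hdevj : ‖𝒟.toSpacetime.deviationExtend ⟨U, boostedKerrBilin (mo j).1 (mo j).2 (M j) (a j),
      fun x ↦ x 0, fun x ↦ Kerr.radius (a j) (poincareInv (mo j).1 (mo j).2 x)⟩ Φ x‖ ≤ ε :=
    norm_le_of_supCkENorm_le hε.le (hnear j) ⟨hx0, hin, hrj.le⟩
  -- LOWER BOUND: `2 H₀ ≤ ‖g_{Kerr,j}(x) − η‖ L₁²`
  have hlow : 2 * H₀ ≤ ‖boostedKerrBilin (mo j).1 (mo j).2 (M j) (a j) x - Minkowski.bilin‖ *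
      L₁ ^ 2 := by
    have h1 := two_mul_le_norm_boostedKerrBilin_sub (mo j).1 (mo j).2 (M j) (a j) hRjpos hxinv
    have h2 : H₀ ≤ M j * R j / (R j ^ 2 + a j ^ 2) := by
      rw [hH₀]
      exact scale_le_kerr_quotient hm₀ (hmarg j).1 haj hRj1.le (by linarith)
    have h4 := (hmarg j).2.2.2.2.2 (E4.basisVector 0)
    rw [show ‖(E4.basisVector 0 : E4)‖ = 1 by simp [E4.basisVector], mul_one] at h4
    have h5 : ‖((mo j).1 : E4 ≃L[ℝ] E4) (E4.basisVector 0)‖ ^ 2 ≤ L₁ ^ 2 :=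
      pow_le_pow_left₀ (norm_nonneg _) (h4.trans hL₁L) 2
    nlinarith [norm_nonneg (boostedKerrBilin (mo j).1 (mo j).2 (M j) (a j) x - Minkowski.bilin)]
  -- UPPER BOUND: `‖g_{Kerr,j}(x) − η‖ ≤ 3 ε₀`
  have hup : ‖boostedKerrBilin (mo j).1 (mo j).2 (M j) (a j) x - Minkowski.bilin‖ ≤ 3 * ε₀ := by
    by_cases hA : ∀ i, R i - 1 ≤ Kerr.radius (a i) (poincareInv (mo i).1 (mo i).2 x)
    · -- (A) `x` is also in the far zone: compare with the flat deviation
      have hdev0 : ‖𝒟.toSpacetime.deviationExtend (Minkowski.backgroundOn U) Φ x‖ ≤ ε :=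
        norm_le_of_supCkENorm_le hε.le hfar ⟨hx0, hin, hA⟩
      have h1 : ‖boostedKerrBilin (mo j).1 (mo j).2 (M j) (a j) x - Minkowski.bilin‖ ≤ ε + ε :=
        norm_sub_bilin_le 𝒟.toSpacetime (Minkowski.backgroundOn U) _ _ _ Φ ⟨x, hxU⟩ hdev0 hdevj
      linarith
    · -- (B) `x` is deep inside the near zone of another hole `i`, which is far away and flat there
      push Not at hA
      obtain ⟨i, hi⟩ := hA
      have hij : i ≠ j := by
        rintro rfl
        rw [hrj] at hi
        linarith
      have hdevi : ‖𝒟.toSpacetime.deviationExtend ⟨U, boostedKerrBilin (mo i).1 (mo i).2 (M i) (a i),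
          fun x ↦ x 0, fun x ↦ Kerr.radius (a i) (poincareInv (mo i).1 (mo i).2 x)⟩ Φ x‖ ≤ ε :=
        norm_le_of_supCkENorm_le hε.le (hnear i) ⟨hx0, hin, by linarith⟩
      have h1 : ‖boostedKerrBilin (mo j).1 (mo j).2 (M j) (a j) x -
          boostedKerrBilin (mo i).1 (mo i).2 (M i) (a i) x‖ ≤ ε + ε :=
        norm_sub_bilin_le 𝒟.toSpacetime ⟨U, boostedKerrBilin (mo i).1 (mo i).2 (M i) (a i),
          fun x ↦ x 0, fun x ↦ Kerr.radius (a i) (poincareInv (mo i).1 (mo i).2 x)⟩ _ _ _ Φ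
          ⟨x, hxU⟩ hdevi hdevj
      obtain ⟨hΘ1, hΘ2, -, hΘ4⟩ := hΘparts i
      have hΘi := hri i hij
      have h2 : ‖boostedKerrBilin (mo i).1 (mo i).2 (M i) (a i) x - Minkowski.bilin‖ ≤ ε₀ :=
        norm_boostedKerrBilin_sub_le_of_radius_ge (mo i).1 (mo i).2 (M i) (a i) hε₀pos (hdec i)
          (hΘ1.trans hΘi) (hΘ4.trans_le hΘi) (hΘ2.trans hΘi)
      have h3 := norm_sub_le_norm_sub_add_norm_sub
        (boostedKerrBilin (mo j).1 (mo j).2 (M j) (a j) x)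
        (boostedKerrBilin (mo i).1 (mo i).2 (M i) (a i) x) Minkowski.bilin
      linarith
  -- contradiction: `2 H₀ ≤ 3 ε₀ L₁² = 3 H₀ / 2`
  have hfin : 3 * ε₀ * L₁ ^ 2 = 3 / 2 * H₀ := by
    rw [hε₀]
    field_simp
  nlinarith [mul_le_mul_of_nonneg_right hup (sq_nonneg L₁)]

end Summit.FinalStateConjecture.FinalStateConjecture.Theorems.KerrnessPropagates.KerrBasinCapture
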